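import Literature.NumberTheory.EllipticCurves.ZpExtensionEisensteinSelmerH5bBadPlacesProofs
import Literature.NumberTheory.EllipticCurves.ZpExtensionEisensteinTwistFixedPointTorsionProofs
import Literature.NumberTheory.EllipticCurves.ZpExtensionEisensteinTwistLocalH1UniformBoundProofs
import HarnessLib

/-!
# Howard's H.5(b) for the curve's Eisenstein setting at the places `v ∈ S` away from `p`: the unconditional clause for
# `m` large (theorems only)

`Proofs` file (theorems only; no definition, no named fact, no instance, no `sorry`).  Topic `NumberTheory/EllipticCurves`
(D1 road of cell `pub/bsd-print-x9`, seat `bsd-line-x9-p1-w3` g5; assembles three accepted inputs):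
* x9-p1-w3's `eisensteinDVRSetting_h5b_clause_zero_of_mem` (`…SelmerH5bBadPlacesProofs`): the `v`-clause of H.5(b) at tower
  level `0` for `v ∈ S`, `p ∉ v`, `σv ∈ S`, `p ∉ σv`, GIVEN (UT) uniform torsion of the local towers at `v`, `σ v` and (SB)
  `[T]^{m-1}` kills their local invariants;
* x9-p1-w4's `exists_forall_pow_smul_galoisCohomology_one_toLocal_eq_zero_uniform` (`…TwistLocalH1UniformBoundProofs`):
  (UT) at a place `v ∤ p` whose decomposition group is not in `ker κ`, for all `m > 2N_v`;
* x9-p1-w3's `ZpExtension.mk_X_pow_pred_smul_eq_zero_of_forall_toLocal` (`…TwistFixedPointTorsionProofs`): (SB) at such a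
  place for all `m > 2p^{s_v}` (`κ(Γ_{K_v}) ∋ p^{s_v}`).
Result: **`WeierstrassCurve.eisensteinDVRSetting_h5b_clause_zero_of_mem_of_not_decomp_le`** — for `v ∈ S ∖ {p}` with
`σ v ∈ S ∖ {p}` such that neither `v` nor `σ v` splits completely in `K_∞/K` (`Γ_{K_w} ⊄ ker κ`), there is `m₁` such that
for every `m > m₁` and every choice of the remaining Eisenstein-setting data the H.5(b) clause at `v` holds at level `0`:
`(θ_v ∘ transport_v)(F̄_𝔮(σ v)) = F̄_𝔮(v)`.  (Under Howard's Heegner hypothesis every `v ∣ N` splits in `K/F` and is then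
finitely decomposed in the anticyclotomic `ℤ_p`-extension, so the hypothesis holds at the bad places; the places above `p`
are NOT covered here.)  No summit statement is proved; BSD is not proved by any of this.

References: [Howard2004HeegnerKolyvagin] §1.3 H.5(b), §2.2, Def. 3.1.2 (arXiv:1202.6340 p. 7 L96–97); [Brink2007] Thm. 2;
[MazurRubinMemoirs2004] Def. 1.1.1.
-/

set_option autoImplicit false

noncomputable section

open Function NumberField IsDedekindDomain Field
open scoped NumberField ContRepresentation TensorProduct Classical

namespace WeierstrassCurve

open Literature.NumberTheory.EllipticCurves Literature.NumberTheory.GaloisRepresentations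
open Literature.NumberTheory.GaloisRepresentations.DiscreteGaloisModule
open Literature.NumberTheory.GaloisCohomology.Howard2004
open Literature.NumberTheory.EllipticCurves.ZpExtension (EisensteinLevel)
open Literature.NumberTheory.EllipticCurves.IwasawaAlgebra

variable {K : Type} [Field K] [NumberField K] (W : WeierstrassCurve ℚ) [W.IsElliptic] {p : ℕ} [hp : Fact p.Prime]
  (κ : ZpExtension K p) (S : Finset (HeightOneSpectrum (𝓞 K)))
  (hpS : ∀ v : HeightOneSpectrum (𝓞 K), ((p : ℕ) : 𝓞 K) ∈ v.asIdeal → v ∈ S)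
  (hbad : ∀ v : HeightOneSpectrum (𝓞 K), v ∉ S → ((p : ℕ) : 𝓞 K) ∉ v.asIdeal → (W.baseChange K).HasGoodReductionAt v)
  (cd : ConjugationDatum K)

/-- A decomposition group not contained in `ker κ` contains an element on which `κ` is non-trivial.
[cite: Brink2007, Thm. 2 (finitely decomposed primes)] -/
theorem exists_apply_absGaloisRestrict_ne_one_of_not_decomp_le (v : HeightOneSpectrum (𝓞 K))
    (hdec : ¬ (GreenbergSelmer.decomp v ≤ κ.kerSubgroup)) :
    ∃ h₀ : absoluteGaloisGroup (v.adicCompletion K), κ (absGaloisRestrict K (v.adicCompletion K) h₀) ≠ 1 := by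
  by_contra hall
  push Not at hall
  exact hdec fun δ hδ ↦ by
    obtain ⟨σ, rfl⟩ := (GreenbergSelmer.mem_decomp_iff v δ).1 hδ
    exact ZpExtension.mem_kerSubgroup.2 (hall σ)

set_option synthInstance.maxHeartbeats 80000 in
set_option maxHeartbeats 800000 in
/-- **H.5(b) at `v ∈ S ∖ {p}` for the curve's Eisenstein setting, unconditionally for `m` large.**  Let `cd` be a
conjugation datum with `κ(τ⁻¹ g τ) = −κ(g)`, and `v ∈ S`, `p ∉ v`, `σ v ∈ S`, `p ∉ σ v` two places whose decomposition
groups are not contained in `ker κ`.  Then there is `m₁` such that for all `m > m₁` and all remaining data of the Eisenstein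
setting, at tower level `0`, `(θ_v ∘ transport_v)(F̄_𝔮(σ v)) = F̄_𝔮(v)` — the `v`-clause of the `hfin` hypothesis of
`eisensteinDVRSetting_h5b_of` at `k = 0`.  Inputs: (UT) `p^{8N} H¹(K_w, E[p^j] ⊗ A_{m,j}(ψ)) = 0` (x9-p1-w4) and (SB)
`[T]^{m-1}` kills the local invariants (Cayley–Hamilton), fed into `eisensteinDVRSetting_h5b_clause_zero_of_mem`.
[cite: Howard2004HeegnerKolyvagin, §1.3 H.5(b) (arXiv:1202.6340 p. 7 L96–97), §2.2, Def. 3.1.2]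
[cite: MazurRubinMemoirs2004, Def. 1.1.1] -/
theorem eisensteinDVRSetting_h5b_clause_zero_of_mem_of_not_decomp_le
    (hanti : ∀ g : absoluteGaloisGroup K, (κ (cd.conj g)).toAdd = -(κ g).toAdd)
    {v : HeightOneSpectrum (𝓞 K)} (hvS : v ∈ S) (hpv : ((p : ℕ) : 𝓞 K) ∉ v.asIdeal) (hσvS : cd.σ • v ∈ S)
    (hpσv : ((p : ℕ) : 𝓞 K) ∉ (cd.σ • v).asIdeal)
    (hdv : ¬ (GreenbergSelmer.decomp v ≤ κ.kerSubgroup))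
    (hdσv : ¬ (GreenbergSelmer.decomp (cd.σ • v) ≤ κ.kerSubgroup)) :
    ∃ m₁ : ℕ, ∀ (m : ℕ) (hm : 1 ≤ m), m₁ < m →
      ∀ (L : Set (HeightOneSpectrum (𝓞 K)))
        (hL : letI := IwasawaAlgebra.isLocalRing_quotient_X_pow_add_C p hm
          L ⊆ (W.eisensteinTower κ hm).degreeTwoPrimes p)
        (hLS : ∀ v ∈ L, v ∉ S) (jbar : AlgebraicClosure K →+* ℂ)
        (D : letI := IwasawaAlgebra.isLocalRing_quotient_X_pow_add_C p hm
          ∀ k, DualityDatum p cd ((W.eisensteinTower κ hm).ρ k) (IwasawaAlgebra.EisensteinCoeff p m (k + 1)))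
        (fs : letI := IwasawaAlgebra.isLocalRing_quotient_X_pow_add_C p hm
          ∀ (k : ℕ) (n : Finset (HeightOneSpectrum (𝓞 K))) (v : HeightOneSpectrum (𝓞 K)),
            galoisCohomology ((W.eisensteinLevelQuot κ hm k n).toLocal (Sum.inr v)) 1 →+
              SingularQuotient (GaloisRep.toLocal v (W.eisensteinLevelQuot κ hm k n)) ⊗[ℤ] Gell v),
      letI := IwasawaAlgebra.isDomain_quotient_X_pow_add_C p hm
      letI := IwasawaAlgebra.isDiscreteValuationRing_quotient_X_pow_add_C p hm
      haveI := IwasawaAlgebra.EisensteinCoeff.isLocalRing_succ p hm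
      letI := IwasawaAlgebra.EisensteinCoeff.algebraOfSpecSucc p m
      haveI := W.isScalarTower_algebraOfSpecSucc (K := K) (p := p) (m := m)
      letI := W.residueModuleSucc (K := K) (p := p) hm
      AddSubgroup.map
          (((W.residualTauGeomTorsion (p := p) cd hm (k := 0 + 1) (Nat.succ_pos 0)).thetaH1 (Sum.inr v)).comp
            (cd.transportH1 ((W.baseChange K).torsionGaloisModule (p : ℤ)) v))
          (((W.isQuotientBy_eisensteinDVRSetting_πbar κ hm S hpS hbad L hL hLS jbar cd D fs 0).propagateStructure
            (W.eisensteinTowerTriple κ hm S hpS hbad L hL hLS 0).cond) (Sum.inr (cd.σ • v))) =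
        ((W.isQuotientBy_eisensteinDVRSetting_πbar κ hm S hpS hbad L hL hLS jbar cd D fs 0).propagateStructure
          (W.eisensteinTowerTriple κ hm S hpS hbad L hL hLS 0).cond) (Sum.inr v) := by
  -- (UT) at `v` and at `σ v`
  obtain ⟨N₁, -, hUT₁⟩ :=
    exists_forall_pow_smul_galoisCohomology_one_toLocal_eq_zero_uniform v (W.baseChange K) κ hpv hdv
  obtain ⟨N₂, -, hUT₂⟩ :=
    exists_forall_pow_smul_galoisCohomology_one_toLocal_eq_zero_uniform (cd.σ • v) (W.baseChange K) κ hpσv hdσv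
  -- (SB): elements of the decomposition groups on which `κ` is a power of `p`
  obtain ⟨h₁, hh₁⟩ := exists_apply_absGaloisRestrict_ne_one_of_not_decomp_le κ v hdv
  obtain ⟨s₁, g₁, hg₁⟩ := κ.exists_toAdd_apply_absGaloisRestrict_eq_pow (v.adicCompletion K) h₁ hh₁
  obtain ⟨h₂, hh₂⟩ := exists_apply_absGaloisRestrict_ne_one_of_not_decomp_le κ (cd.σ • v) hdσv
  obtain ⟨s₂, g₂, hg₂⟩ := κ.exists_toAdd_apply_absGaloisRestrict_eq_pow ((cd.σ • v).adicCompletion K) h₂ hh₂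
  refine ⟨2 * (N₁ + N₂ + p ^ s₁ + p ^ s₂), fun m hm hm₁ L hL hLS jbar D fs ↦ ?_⟩
  refine W.eisensteinDVRSetting_h5b_clause_zero_of_mem κ hm S hpS hbad L hL hLS jbar cd D fs hanti hvS hpv hσvS hpσv
    (c := 8 * N₁ + 8 * N₂) (fun w hw j y ↦ ?_) (fun w hw j x hx ↦ ?_)
  · -- (UT)
    rcases hw with rfl | hw
    · have h1 : p ^ (8 * N₁) • y = 0 := hUT₁ m hm (by omega) j y
      rw [pow_add, mul_comm, mul_smul, h1, smul_zero]
    · rw [Set.mem_singleton_iff] at hw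
      subst hw
      have h2 : p ^ (8 * N₂) • y = 0 := hUT₂ m hm (by omega) j y
      rw [pow_add, mul_smul, h2, smul_zero]
  · -- (SB)
    rcases hw with rfl | hw
    · exact ZpExtension.mk_X_pow_pred_smul_eq_zero_of_forall_toLocal (E := W.baseChange K) (κ' := κ) (hm := hm)
        (w := w) hg₁ (by omega) j x hx
    · rw [Set.mem_singleton_iff] at hw
      subst hw
      exact ZpExtension.mk_X_pow_pred_smul_eq_zero_of_forall_toLocal (E := W.baseChange K) (κ' := κ) (hm := hm)
        (w := cd.σ • v) hg₂ (by omega) j x hx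

end WeierstrassCurve

end
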